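import Mathlib
import Summits.Ventures.PercRepro2.HCov
import Summits.Ventures.PercRepro2.RootLeafUSigns
import Summits.Ventures.PercRepro2.RootLeafUSignsBC
import Summits.Ventures.PercRepro2.RootLeafUCells
import Summits.Ventures.PercRepro2.RootLeafUAtoms1
import Summits.Ventures.PercRepro2.RootLeafUAtoms2
import Summits.Ventures.PercRepro2.RootLeafUAtoms3
import Summits.Ventures.PercRepro2.RootLeafUEvents

set_option synthInstance.maxSize 2048

/-!
# A ROOT as a leaf at an UNMARKED vertex `u`, part 3: the root-leaf cubic, its first coefficient
`T1 ≥ 0`, and (HCOV) modulo the second coefficient (blind cell PercRepro2, p4 g3; S3 (G4-u),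
proofs/subclaims/S3-CLASSES.md §S3.10 (G4-u) v27–v29, proofs/P4-G4U-T1.md)

The root `a₁` is a LEAF attached to the UNMARKED vertex `u` by the single edge `f` (`q = p f`),
the five marks `o, a₁, a₂, c = a₃, b` distinct and `u` distinct from `o, a₂, c, b`.

* **`Gc_root_leaf_u`**: `Gc = (1−q)³·T0 + q(1−q)²·T1 + q²(1−q)·T2 + q³·Gc(a₁ := u)` — the cubic
  form `Gc = T(m, m, m)` evaluated at the `q`-mixtures `m = q·m¹ + (1−q)·m⁰` of the twelve masses
  (`RootLeafUEvents`), with `T0 = T(m⁰,m⁰,m⁰)`, `T1 = T(m¹,m⁰,m⁰) + T(m⁰,m¹,m⁰) + T(m⁰,m⁰,m¹)`,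
  `T2 = T(m¹,m¹,m⁰) + T(m¹,m⁰,m¹) + T(m⁰,m¹,m¹)` and `T(m¹,m¹,m¹) = Gc(a₁ := u)`.
* **`T0_eq_zero`**: the isolated-root world vanishes (the (ONE-ROOT) zero), a polynomial identity
  in the 35 cells.
* **`T1_eq`**: the K-exploration form of the first coefficient,
  `T1 = 2·[d0·(A) + d0·(B) + d0·(C) + d0·(D)]` (S3 v27 (1), homogenised with `S = P(Ω)`), a
  polynomial identity in the 35 cells (`RootLeafUAtoms1–3`).
* **`T1_nonneg`**: `0 ≤ T1` — the four signs `I3_nonneg` (the (I3) theorem), `B_nonneg`,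
  `I2_nonneg` and a mass (`RootLeafUSigns`, `RootLeafUSignsBC`).
* **`HCov_root_leaf_u_of`**: (HCOV) for the root-leaf instance follows from `0 ≤ T2` and (HCOV)
  for the instance `a₁ := u` on `G − a₁` — the class (G4-u) reduced to its second coefficient.
-/

namespace Summit.Ventures.PercRepro2

open UnionCluster CovForm PendantRoot

namespace RootLeafU

variable {V : Type*} {E : Type*} [Fintype E] [DecidableEq E] [Fintype V] [DecidableEq V]
  {R : Type*} [Field R] [LinearOrder R] [IsStrictOrderedRing R]

section Coefficients

variable (p : E → R) (ends : E → Sym2 V) (o a₂ c b u : V)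

/-- The isolated-root world value `T(m⁰, m⁰, m⁰)`. -/
noncomputable def T0 : R := prob p Set.univ * prob p (avoidAll ends a₂ {c}) * prob p (connEvent ends a₂ o ∩ connEvent ends a₂ b) + prob p Set.univ * prob p (avoidAll ends a₂ {c} ∩ connEvent ends a₂ o) * prob p (connEvent ends a₂ c ∩ connEvent ends a₂ b) - prob p Set.univ * prob p (avoidAll ends a₂ {c}) * prob p (connEvent ends a₂ c ∩ (connEvent ends a₂ o ∩ connEvent ends a₂ b)) + prob p (connEvent ends a₂ b) * prob p (avoidAll ends a₂ {c}) * (-prob p (connEvent ends a₂ o)) + prob p (connEvent ends a₂ b) * prob p (avoidAll ends a₂ {c} ∩ connEvent ends a₂ o) * (-prob p (connEvent ends a₂ c)) - prob p (connEvent ends a₂ b) * prob p (avoidAll ends a₂ {c}) * (-prob p (connEvent ends a₂ c ∩ connEvent ends a₂ o)) + prob p Set.univ * prob p (avoidAll ends a₂ {c} ∩ connEvent ends a₂ o) * prob p (avoidAll ends a₂ {c} ∩ connEvent ends a₂ b) - prob p Set.univ * prob p (avoidAll ends a₂ {c}) * prob p (avoidAll ends a₂ {c} ∩ (connEvent ends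 a₂ o ∩ connEvent ends a₂ b))

/-- The first Bernstein coefficient `T(m¹,m⁰,m⁰) + T(m⁰,m¹,m⁰) + T(m⁰,m⁰,m¹)`. -/
noncomputable def T1 : R := (prob p (avoidAll ends a₂ {u}) * prob p (avoidAll ends a₂ {c}) * prob p (connEvent ends a₂ o ∩ connEvent ends a₂ b) + prob p (avoidAll ends a₂ {u}) * prob p (avoidAll ends a₂ {c} ∩ connEvent ends a₂ o) * prob p (connEvent ends a₂ c ∩ connEvent ends a₂ b) - prob p (avoidAll ends a₂ {u}) * prob p (avoidAll ends a₂ {c}) * prob p (connEvent ends a₂ c ∩ (connEvent ends a₂ o ∩ connEvent ends a₂ b)) + gap p ends u a₂ b * prob p (avoidAll ends a₂ {c}) * (-prob p (connEvent ends a₂ o)) + gap p ends u a₂ b * prob p (avoidAll ends a₂ {c} ∩ connEvent ends a₂ o) * (-prob p (connEvent ends a₂ c)) - gap p ends u a₂ b * prob p (avoidAll ends a₂ {c}) * (-prob p (connEvent ends a₂ c ∩ connEvent ends a₂ o)) + prob p (avoidAll ends a₂ {u}) * prob p (avoidAll ends a₂ {c} ∩ connEvent ends a₂ o) * prob p (avoidAll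 ends a₂ {c} ∩ connEvent ends a₂ b) - prob p (avoidAll ends a₂ {u}) * prob p (avoidAll ends a₂ {c}) * prob p (avoidAll ends a₂ {c} ∩ (connEvent ends a₂ o ∩ connEvent ends a₂ b))) + (prob p Set.univ * prob p (PDEvent ends u a₂ c) * prob p (connEvent ends a₂ o ∩ connEvent ends a₂ b) + prob p Set.univ * Do p ends o u a₂ c * prob p (connEvent ends a₂ c ∩ connEvent ends a₂ b) - prob p Set.univ * prob p (PDEvent ends u a₂ c) * prob p (connEvent ends a₂ c ∩ (connEvent ends a₂ o ∩ connEvent ends a₂ b)) + prob p (connEvent ends a₂ b) * prob p (PDEvent ends u a₂ c) * (-prob p (connEvent ends a₂ o)) + prob p (connEvent ends a₂ b) * Do p ends o u a₂ c * (-prob p (connEvent ends a₂ c)) - prob p (connEvent ends a₂ b) * prob p (PDEvent ends u a₂ c) * (-prob p (connEvent ends a₂ c ∩ connEvent ends a₂ o)) + prob p Set.univ * Do p ends o u a₂ c * prob p (avoidAll ends a₂ {c} ∩ connEvent ends a₂ b) - prob p Set.univ * prob p (PDEvent ends u a₂ c) * prob p (avoidAll ends a₂ {c} ∩ (connEvent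 ends a₂ o ∩ connEvent ends a₂ b))) + (prob p Set.univ * prob p (avoidAll ends a₂ {c}) * EQbo p ends o u a₂ b + prob p Set.univ * prob p (avoidAll ends a₂ {c} ∩ connEvent ends a₂ o) * EQb3 p ends u a₂ c b - prob p Set.univ * prob p (avoidAll ends a₂ {c}) * EQb3o p ends o u a₂ c b + prob p (connEvent ends a₂ b) * prob p (avoidAll ends a₂ {c}) * EQo p ends o u a₂ + prob p (connEvent ends a₂ b) * prob p (avoidAll ends a₂ {c} ∩ connEvent ends a₂ o) * EQ3 p ends u a₂ c - prob p (connEvent ends a₂ b) * prob p (avoidAll ends a₂ {c}) * EQ3o p ends o u a₂ c + prob p Set.univ * prob p (avoidAll ends a₂ {c} ∩ connEvent ends a₂ o) * PDb p ends u a₂ c b - prob p Set.univ * prob p (avoidAll ends a₂ {c}) * PDbo p ends o u a₂ c b)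

/-- The second Bernstein coefficient `T(m¹,m¹,m⁰) + T(m¹,m⁰,m¹) + T(m⁰,m¹,m¹)`. -/
noncomputable def T2 : R := (prob p (avoidAll ends a₂ {u}) * prob p (PDEvent ends u a₂ c) * prob p (connEvent ends a₂ o ∩ connEvent ends a₂ b) + prob p (avoidAll ends a₂ {u}) * Do p ends o u a₂ c * prob p (connEvent ends a₂ c ∩ connEvent ends a₂ b) - prob p (avoidAll ends a₂ {u}) * prob p (PDEvent ends u a₂ c) * prob p (connEvent ends a₂ c ∩ (connEvent ends a₂ o ∩ connEvent ends a₂ b)) + gap p ends u a₂ b * prob p (PDEvent ends u a₂ c) * (-prob p (connEvent ends a₂ o)) + gap p ends u a₂ b * Do p ends o u a₂ c * (-prob p (connEvent ends a₂ c)) - gap p ends u a₂ b * prob p (PDEvent ends u a₂ c) * (-prob p (connEvent ends a₂ c ∩ connEvent ends a₂ o)) + prob p (avoidAll ends a₂ {u}) * Do p ends o u a₂ c * prob p (avoidAll ends a₂ {c} ∩ connEvent ends a₂ b) - prob p (avoidAll ends a₂ {u}) * prob p (PDEvent ends u a₂ c) * prob p (avoidAll ends a₂ {c} ∩ (connEvent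 ends a₂ o ∩ connEvent ends a₂ b))) + (prob p (avoidAll ends a₂ {u}) * prob p (avoidAll ends a₂ {c}) * EQbo p ends o u a₂ b + prob p (avoidAll ends a₂ {u}) * prob p (avoidAll ends a₂ {c} ∩ connEvent ends a₂ o) * EQb3 p ends u a₂ c b - prob p (avoidAll ends a₂ {u}) * prob p (avoidAll ends a₂ {c}) * EQb3o p ends o u a₂ c b + gap p ends u a₂ b * prob p (avoidAll ends a₂ {c}) * EQo p ends o u a₂ + gap p ends u a₂ b * prob p (avoidAll ends a₂ {c} ∩ connEvent ends a₂ o) * EQ3 p ends u a₂ c - gap p ends u a₂ b * prob p (avoidAll ends a₂ {c}) * EQ3o p ends o u a₂ c + prob p (avoidAll ends a₂ {u}) * prob p (avoidAll ends a₂ {c} ∩ connEvent ends a₂ o) * PDb p ends u a₂ c b - prob p (avoidAll ends a₂ {u}) * prob p (avoidAll ends a₂ {c}) * PDbo p ends o u a₂ c b) + (prob p Set.univ * prob p (PDEvent ends u a₂ c) * EQbo p ends o u a₂ b + prob p Set.univ * Do p ends o u a₂ c * EQb3 p ends u a₂ c b - prob p Set.univ * prob p (PDEvent ends u a₂ c)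 * EQb3o p ends o u a₂ c b + prob p (connEvent ends a₂ b) * prob p (PDEvent ends u a₂ c) * EQo p ends o u a₂ + prob p (connEvent ends a₂ b) * Do p ends o u a₂ c * EQ3 p ends u a₂ c - prob p (connEvent ends a₂ b) * prob p (PDEvent ends u a₂ c) * EQ3o p ends o u a₂ c + prob p Set.univ * Do p ends o u a₂ c * PDb p ends u a₂ c b - prob p Set.univ * prob p (PDEvent ends u a₂ c) * PDbo p ends o u a₂ c b)

omit [LinearOrder R] [IsStrictOrderedRing R] in
include u in
set_option maxHeartbeats 1000000 in
/-- The isolated-root world vanishes: `T0 = 0` (a polynomial identity in the 35 cells, decomposed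
with the fifth vertex `u`). -/
theorem T0_eq_zero : T0 p ends o a₂ c b = 0 := by
  unfold T0
  rw [cells_univ p ends o a₂ c b u, cells_Nc p ends o a₂ c b u, cells_Nc_ao p ends o a₂ c b u, cells_ao_ab p ends o a₂ c b u, cells_ac_ab p ends o a₂ c b u, cells_ac_ao_ab p ends o a₂ c b u, cells_ao p ends o a₂ c b u, cells_ac p ends o a₂ c b u, cells_ac_ao p ends o a₂ c b u, cells_Nc_ab p ends o a₂ c b u, cells_Nc_ao_ab p ends o a₂ c b u, cells_ab p ends o a₂ c b u]
  ring

omit [LinearOrder R] [IsStrictOrderedRing R] in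
set_option maxHeartbeats 4000000 in
/-- **The K-exploration form of the first coefficient** (S3 v27 (1), homogenised):
`T1 = 2·[hb·e0·P(W) − S·e0·P(W,bH) − hb·d0·P(W,oH) + S·d0·P(W,oH,bH) + d0·hb·P(Y) − d0·S·P(Y,bH)
 + e0·S·P(C₁) − d0·S·P(C₂) + S·d0·P(D)]`, a polynomial identity in the 35 cells. -/
theorem T1_eq : T1 p ends o a₂ c b u = 2 * (prob p (connEvent ends a₂ b) * prob p (connEvent ends a₂ o ∩ (connEvent ends c a₂)ᶜ) * prob p (connEvent ends c u ∩ (connEvent ends c a₂)ᶜ) - prob p Set.univ * prob p (connEvent ends a₂ o ∩ (connEvent ends c a₂)ᶜ) * prob p (connEvent ends c u ∩ connEvent ends a₂ b ∩ (connEvent ends c a₂)ᶜ) - prob p (connEvent ends a₂ b) * prob p (connEvent ends c a₂)ᶜ * prob p (connEvent ends c u ∩ connEvent ends a₂ o ∩ (connEvent ends c a₂)ᶜ) + prob p Set.univ * prob p (connEvent ends c a₂)ᶜ * prob p (connEvent ends c u ∩ (connEvent ends a₂ o ∩ connEvent ends a₂ b) ∩ (connEvent ends c a₂)ᶜ) +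 prob p (connEvent ends c a₂)ᶜ * prob p (connEvent ends a₂ b) * prob p (connEvent ends u o ∩ (connEvent ends u c)ᶜ ∩ (connEvent ends u a₂)ᶜ) - prob p (connEvent ends c a₂)ᶜ * prob p Set.univ * prob p (connEvent ends u o ∩ (connEvent ends u c)ᶜ ∩ connEvent ends a₂ b ∩ (connEvent ends u a₂)ᶜ) + prob p (connEvent ends a₂ o ∩ (connEvent ends a₂ c)ᶜ) * prob p Set.univ * prob p (connEvent ends u b ∩ avoidAll ends a₂ {c, u}) - prob p (connEvent ends a₂ c)ᶜ * prob p Set.univ * prob p (connEvent ends a₂ o ∩ connEvent ends u b ∩ avoidAll ends a₂ {c, u}) + prob p Set.univ * prob p (connEvent ends c a₂)ᶜ * prob p (connEvent ends u b ∩ connEvent ends u o ∩ connEvent ends a₂ c ∩ (connEvent ends u a₂)ᶜ)) := by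
  unfold T1 EQbo EQb3 EQb3o EQo EQ3 EQ3o PDb PDbo Do gap
  rw [cells_univ p ends o a₂ c b u, cells_Nc p ends o a₂ c b u, cells_Nc_ao p ends o a₂ c b u, cells_ao_ab p ends o a₂ c b u, cells_ac_ab p ends o a₂ c b u, cells_ac_ao_ab p ends o a₂ c b u, cells_ao p ends o a₂ c b u, cells_ac p ends o a₂ c b u, cells_ac_ao p ends o a₂ c b u, cells_Nc_ab p ends o a₂ c b u, cells_Nc_ao_ab p ends o a₂ c b u, cells_ab p ends o a₂ c b u, cells_Q_uo_ub p ends o a₂ c b u, cells_Q_ao_ab p ends o a₂ c b u, cells_Q_ao_ub p ends o a₂ c b u, cells_Q_uo_ab p ends o a₂ c b u, cells_Tp_ub p ends o a₂ c b u, cells_T_ab p ends o a₂ c b u, cells_T_ub p ends o a₂ c b u, cells_Tp_ab p ends o a₂ c b u, cells_Tp_uo_ub p ends o a₂ c b u, cells_Tp_ao_ub p ends o a₂ c b u, cells_T_uo_ab p ends o a₂ c b u, cells_T_ao_ab p ends o a₂ c b u, cells_T_uo_ub p ends o a₂ c b u, cells_T_ao_ub p ends o a₂ c b u, cells_Tp_uo_ab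 p ends o a₂ c b u, cells_Tp_ao_ab p ends o a₂ c b u, cells_Q_uo p ends o a₂ c b u, cells_Q_ao p ends o a₂ c b u, cells_Tp p ends o a₂ c b u, cells_T p ends o a₂ c b u, cells_Tp_uo p ends o a₂ c b u, cells_Tp_ao p ends o a₂ c b u, cells_T_uo p ends o a₂ c b u, cells_T_ao p ends o a₂ c b u, cells_PD_ub p ends o a₂ c b u, cells_PD_ab p ends o a₂ c b u, cells_PD_uo_ub p ends o a₂ c b u, cells_PD_ao_ub p ends o a₂ c b u, cells_PD_uo_ab p ends o a₂ c b u, cells_PD_ao_ab p ends o a₂ c b u, cells_PD_uo p ends o a₂ c b u, cells_PD_ao p ends o a₂ c b u, cells_PD p ends o a₂ c b u, cells_Q p ends o a₂ c b u, cells_ub p ends o a₂ c b u, cells_I3_e0 p ends o a₂ c b u, cells_I3_W p ends o a₂ c b u, cells_I3_Wb p ends o a₂ c b u, cells_I3_d0 p ends o a₂ c b u, cells_I3_Wo p ends o a₂ c b u, cells_I3_Wob p ends o a₂ c b u, cells_B_Yb p ends o a₂ c b u, cells_B_Y p ends o a₂ c b u, cells_I2_d0 p ends o a₂ c b u, cells_I2_C2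 p ends o a₂ c b u, cells_I2_e0 p ends o a₂ c b u, cells_I2_C1 p ends o a₂ c b u, cells_Dev p ends o a₂ c b u]
  ring

/-- **The first coefficient is nonnegative**: `0 ≤ T1` — the (I3) theorem `I3_nonneg`, the (B)
and (C) = (I2) signs and a mass. -/
theorem T1_nonneg (hp : IsProbVec p) : 0 ≤ T1 p ends o a₂ c b u := by
  rw [T1_eq, prob_univ]
  have hA := I3_nonneg p ends o a₂ c b u hp
  have hB := B_nonneg p ends o a₂ c b u hp
  have hC := I2_nonneg p ends o a₂ c b u hp
  have hd0 : 0 ≤ prob p (connEvent ends c a₂)ᶜ := prob_nonneg hp _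
  have hD : 0 ≤ prob p (connEvent ends u b ∩ connEvent ends u o ∩ connEvent ends a₂ c ∩ (connEvent ends u a₂)ᶜ) := prob_nonneg hp _
  have hB' : 0 ≤ prob p (connEvent ends c a₂)ᶜ * (prob p (connEvent ends a₂ b) * prob p (connEvent ends u o ∩ (connEvent ends u c)ᶜ ∩ (connEvent ends u a₂)ᶜ) - prob p (connEvent ends u o ∩ (connEvent ends u c)ᶜ ∩ connEvent ends a₂ b ∩ (connEvent ends u a₂)ᶜ)) := mul_nonneg hd0 (by linarith)
  have hD' : 0 ≤ prob p (connEvent ends c a₂)ᶜ * prob p (connEvent ends u b ∩ connEvent ends u o ∩ connEvent ends a₂ c ∩ (connEvent ends u a₂)ᶜ) := mul_nonneg hd0 hD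
  nlinarith [hA, hB', hC, hD']

end Coefficients

section Main

variable (p : E → R) (ends : E → Sym2 V)

omit [Fintype V] [DecidableEq V] [LinearOrder R] [IsStrictOrderedRing R] in
set_option maxHeartbeats 2000000 in
/-- **The root-leaf cubic**: for `a₁` a leaf at the unmarked `u` (edge `f`, weight `q = p f`),
`Gc = (1−q)³·T0 + q(1−q)²·T1 + q²(1−q)·T2 + q³·Gc(a₁ := u)`. -/
theorem Gc_root_leaf_u {f : E} {a₁ u : V} (hf : ends f = s(a₁, u))
    (hleaf : ∀ e, a₁ ∈ ends e → e = f) (h1u : a₁ ≠ u) {o a₂ c b : V} (h12 : a₁ ≠ a₂)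
    (h1c : a₁ ≠ c) (h1o : a₁ ≠ o) (h1b : a₁ ≠ b) :
    Gc p ends o a₁ a₂ c b =
      (1 - p f) ^ 3 * T0 p ends o a₂ c b + p f * (1 - p f) ^ 2 * T1 p ends o a₂ c b u +
        (p f) ^ 2 * (1 - p f) * T2 p ends o a₂ c b u + (p f) ^ 3 * Gc p ends o u a₂ c b := by
  unfold Gc DEF
  rw [split_PQ p hf hleaf h1u h12, split_D p hf hleaf h1u h12 h1c, split_Do p hf hleaf h1u h12 h1c h1o,
    split_EQbo p hf hleaf h1u h12 h1o h1b, split_EQb3 p hf hleaf h1u h12 h1c h1b,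
    split_EQb3o p hf hleaf h1u h12 h1c h1o h1b, split_EQo p hf hleaf h1u h12 h1o,
    split_EQ3 p hf hleaf h1u h12 h1c, split_EQ3o p hf hleaf h1u h12 h1c h1o,
    split_PDb p hf hleaf h1u h12 h1c h1b, split_PDbo p hf hleaf h1u h12 h1c h1o h1b,
    split_gap p hf hleaf h1u h1b]
  unfold T0 T1 T2
  ring

/-- **(HCOV) for a root leaf at an unmarked vertex, modulo the second coefficient**: if
`0 ≤ T2` and (HCOV) holds for the instance `a₁ := u` on `G − a₁`, then (HCOV) holds for the
root-leaf instance (every weight `q` of the leaf edge). -/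
theorem HCov_root_leaf_u_of (hp : IsProbVec p) {f : E} {a₁ u : V} (hf : ends f = s(a₁, u))
    (hleaf : ∀ e, a₁ ∈ ends e → e = f) (h1u : a₁ ≠ u) {o a₂ c b : V} (h12 : a₁ ≠ a₂)
    (h1c : a₁ ≠ c) (h1o : a₁ ≠ o) (h1b : a₁ ≠ b) (hT2 : 0 ≤ T2 p ends o a₂ c b u)
    (h3 : HCov p ends o u a₂ c b) : HCov p ends o a₁ a₂ c b := by
  unfold HCov at h3 ⊢
  rw [Gc_root_leaf_u p ends hf hleaf h1u h12 h1c h1o h1b, T0_eq_zero p ends o a₂ c b u]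
  have hq0 : 0 ≤ p f := hp.nonneg f
  have hq1 : 0 ≤ 1 - p f := by linarith [hp.le_one f]
  have hT1 := T1_nonneg p ends o a₂ c b u hp
  have t1 : 0 ≤ p f * (1 - p f) ^ 2 * T1 p ends o a₂ c b u :=
    mul_nonneg (mul_nonneg hq0 (pow_nonneg hq1 2)) hT1
  have t2 : 0 ≤ (p f) ^ 2 * (1 - p f) * T2 p ends o a₂ c b u :=
    mul_nonneg (mul_nonneg (pow_nonneg hq0 2) hq1) hT2
  have t3 : 0 ≤ (p f) ^ 3 * Gc p ends o u a₂ c b := mul_nonneg (pow_nonneg hq0 3) h3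
  linarith

end Main

end RootLeafU

end Summit.Ventures.PercRepro2
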